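import Mathlib
import Summits.KontsevichZagierPeriods.KontsevichZagierPeriods.Theorems.SoloInformedKummerInvolution
import HarnessLib
import HarnessLib.Audit

/-!
# Kummer family IV: negative pole parameters, and the fixed point of the pole involution (s40)

Sequel to `SoloInformedKummerInvolution` (THEOREM XXVIII(c): for real algebraic `0 < m < 1`,
`n < 1`, `N = (m−n)/(1−n)`, the move form `⟦[pt,1−m]⟧·⟦Π_N⟧ = ⟦[pt,1−n]⟧·⟦Q_n⟧`,
`Q_n = [(0,1), f(1−mx²)/(1−nx²)]`, `f = ((1−x²)(1−mx²))^{-1/2}`).  Here rule (1b) finishes the job.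

* PARTIAL FRACTIONS (`n ≠ 0`): `(1−mx²)/(1−nx²) = m/n + (1−m/n)/(1−nx²)`, so
  `⟦Q_n⟧ = ⟦[pt,m/n]⟧·⟦K⟧ + ⟦[pt,1−m/n]⟧·⟦Π_n⟧` and THEOREM XXVIII(c) becomes the classical
  `(1−m)·Π(N | m) = (1−n)·[(m/n)·K(m) + (1−m/n)·Π(n | m)]`; for `n < 0` one has `m < N < 1`, so
  the NEGATIVE pole parameters are reduced to the circular band [AS64, 17.7.15–17.7.17], in `P`,
  with no input beyond the Kontsevich–Zagier rules: together with THEOREM XXVIII (bands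
  `0 < n < m`, `m < n < 1`) the third-kind reciprocity law covers every real algebraic `n < 1`.
* THE FIXED POINT `n = N = 1 − √(1−m)`.  Writing `m = 1 − k'²`, the pole of `Π(1−k' | m)` sits at
  the real 4-torsion point `u₀ = K/2` of the curve (`sn²(K/2) = 1/(1+k')`), and the move of
  THEOREM XXVIII(c) maps `Π_{1−k'}` to ITSELF up to `Q`: `k'²·⟦Π⟧ = k'·⟦Q⟧`, while rule (1b) gives
  `⟦Q⟧ + k'·⟦Π⟧ = (1+k')·⟦K⟧`.  Hence `2k'·⟦Π(1−k' | m)⟧ = (1+k')·⟦K(m)⟧` in `P`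
  [AS64, 17.7.23 at `φ = π/2`]: a complete integral of the THIRD kind that is an algebraic
  multiple of `K` with NO `π`-term — the hyperbolic twin of THEOREM XXIV (`n = k`, pole at
  `K + iK'/2`, where the answer is `K/2 + (π/4)(1+k)^{-1}…`-type with a `π`-term), and, like it, a
  torsion phenomenon: the third-kind part of `Π(n | m)` is the logarithmic form with residue
  divisor `(P_+) − (P_−)`, `P_± = (1/√n, ±…)`, and `P_+ − P_− = 2u₀` is 2-torsion exactly here.

References: A. M. Legendre, Traité des fonctions elliptiques I (1825), ch. XXIII;
M. Abramowitz – I. Stegun, Handbook of Mathematical Functions (1964), §17.7 (17.7.15–17.7.25);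
P. F. Byrd – M. D. Friedman, Handbook of Elliptic Integrals (1971), 110–117, 410–415;
M. Kontsevich – D. Zagier, Periods (2001), §1.2; this work.
-/

noncomputable section

open MeasureTheory Set Filter
open scoped Classical

open Literature.NumberTheory.Transcendental Literature.NumberTheory.Transcendental.KZ
open Literature.ModelTheory.ExponentialFields

namespace Summit.KontsevichZagierPeriods.KontsevichZagierPeriods.Theorems

/-! ### Rule (1b): the partial fraction of `Q_n` -/

/-- **Partial fractions.** For real algebraic `m`, `n < 1`, `n ≠ 0` and representations
`Q_n = [(0,1), f(1−mx²)/(1−nx²)]`, `K = [(0,1), f]`, `Π_n = [(0,1), f/(1−nx²)]` on the slab: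
`⟦Q_n⟧ = ⟦[pt, m/n]⟧·⟦K⟧ + ⟦[pt, 1−m/n]⟧·⟦Π_n⟧` — ONE application of rule (1b). [this work] -/
theorem soloInformed_kummerQ_partialFractions (m n : ℝ) (hn : n < 1) (hn0 : n ≠ 0)
    (hc1 : IsAlgebraic ℚ (m / n)) (hc2 : IsAlgebraic ℚ (1 - m / n)) (Q K P : IntegralRep 1)
    (hQd : Q.domain = {x | x 0 ∈ Ioo (0:ℝ) 1})
    (hQi : EqOn Q.integrand (fun x => (1 - m * x 0 ^ 2) / (1 - n * x 0 ^ 2) *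
      ((√(1 - x 0 ^ 2))⁻¹ * (√(1 - m * x 0 ^ 2))⁻¹)) Q.domain)
    (hKd : K.domain = {x | x 0 ∈ Ioo (0:ℝ) 1})
    (hKi : EqOn K.integrand (fun x => (√(1 - x 0 ^ 2))⁻¹ * (√(1 - m * x 0 ^ 2))⁻¹) K.domain)
    (hPd : P.domain = {x | x 0 ∈ Ioo (0:ℝ) 1})
    (hPi : EqOn P.integrand (fun x => (1 - n * x 0 ^ 2)⁻¹ *
      ((√(1 - x 0 ^ 2))⁻¹ * (√(1 - m * x 0 ^ 2))⁻¹)) P.domain) :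
    toFormalPeriod (of Q) =
      toFormalPeriod (of (IntegralRep.unit.constMul (m / n) hc1)) * toFormalPeriod (of K) +
        toFormalPeriod (of (IntegralRep.unit.constMul (1 - m / n) hc2)) *
          toFormalPeriod (of P) := by
  have hmem : of Q - of (K.constMul (m / n) hc1) - of (P.constMul (1 - m / n) hc2) ∈
      integrandAddRel := by
    refine ⟨1, Q, _, _, by rw [IntegralRep.domain_constMul, hKd, hQd],
      by rw [IntegralRep.domain_constMul, hPd, hQd], fun x hx => ?_, rfl⟩
    have hx' : x 0 ∈ Ioo (0:ℝ) 1 := by rw [hQd] at hx; exact hx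
    have hp : 1 - n * x 0 ^ 2 ≠ 0 := (soloInformed_poleFactor_pos hx' hn).ne'
    have key : (1 - m * x 0 ^ 2) / (1 - n * x 0 ^ 2) =
        m / n + (1 - m / n) * (1 - n * x 0 ^ 2)⁻¹ := by
      rw [div_eq_iff hp, add_mul, mul_assoc, inv_mul_cancel₀ hp, mul_one, mul_sub, mul_one,
        ← mul_assoc, div_mul_cancel₀ m hn0]
      ring
    have hxK : x ∈ K.domain := by rw [hKd]; exact hx'
    have hxP : x ∈ P.domain := by rw [hPd]; exact hx'
    simp only [Pi.add_apply, IntegralRep.integrand_constMul, hQi hx, hKi hxK, hPi hxP]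
    rw [key]
    ring
  have h := integrandAddRel_subset_relations hmem
  rw [sub_sub] at h
  have h' := toFormalPeriod_eq_iff.mpr h
  rwa [map_add, toFormalPeriod_of_constMul _ _ K, toFormalPeriod_of_constMul _ _ P] at h'

/-! ### THEOREM XXVIII(c): the law for every pole parameter `n < 1`, `n ≠ 0` -/

/-- **THEOREM XXVIII(c) (the pole involution law; negative parameters).** For real algebraic
`0 < m < 1`, `n < 1`, `n ≠ 0`, `N = (m−n)/(1−n)`, with `Π_N`, `K`, `Π_n` represented on `(0,1)`:
`⟦[pt,1−m]⟧·⟦Π_N⟧ = ⟦[pt,1−n]⟧·(⟦[pt,m/n]⟧·⟦K⟧ + ⟦[pt,1−m/n]⟧·⟦Π_n⟧)` in `P` — ONE move of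
rule (2) and ONE application of rule (1b).  For `n < 0` (`m < N < 1`) this is
[AS64, 17.7.17]. [this work] -/
theorem soloInformed_kummer_poleInvolution_law (m n : ℝ) (hm : m ∈ Ioo (0:ℝ) 1)
    (hma : IsAlgebraic ℚ m) (hn : n < 1) (hn0 : n ≠ 0) (hna : IsAlgebraic ℚ n)
    (hc1 : IsAlgebraic ℚ (m / n)) (hc2 : IsAlgebraic ℚ (1 - m / n)) (PN K P : IntegralRep 1)
    (hPNd : PN.domain = {x | x 0 ∈ Ioo (0:ℝ) 1})
    (hPNi : EqOn PN.integrand (fun x => (1 - (m - n) / (1 - n) * x 0 ^ 2)⁻¹ *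
      ((√(1 - x 0 ^ 2))⁻¹ * (√(1 - m * x 0 ^ 2))⁻¹)) PN.domain)
    (hKd : K.domain = {x | x 0 ∈ Ioo (0:ℝ) 1})
    (hKi : EqOn K.integrand (fun x => (√(1 - x 0 ^ 2))⁻¹ * (√(1 - m * x 0 ^ 2))⁻¹) K.domain)
    (hPd : P.domain = {x | x 0 ∈ Ioo (0:ℝ) 1})
    (hPi : EqOn P.integrand (fun x => (1 - n * x 0 ^ 2)⁻¹ *
      ((√(1 - x 0 ^ 2))⁻¹ * (√(1 - m * x 0 ^ 2))⁻¹)) P.domain) :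
    toFormalPeriod (of (IntegralRep.unit.constMul (1 - m) (isAlgebraic_one.sub hma))) *
        toFormalPeriod (of PN) =
      toFormalPeriod (of (IntegralRep.unit.constMul (1 - n) (isAlgebraic_one.sub hna))) *
        (toFormalPeriod (of (IntegralRep.unit.constMul (m / n) hc1)) * toFormalPeriod (of K) +
          toFormalPeriod (of (IntegralRep.unit.constMul (1 - m / n) hc2)) *
            toFormalPeriod (of P)) := by
  obtain ⟨Q, hQd, hQi⟩ := soloInformed_exists_kummerQ_rep n m hn hna hm hma
  rw [soloInformed_kummer_involution m n hm hma hn hna PN Q hPNd hPNi hQd (fun x _ => hQi x),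
    soloInformed_kummerQ_partialFractions m n hn hn0 hc1 hc2 Q K P hQd (fun x _ => hQi x) hKd hKi
      hPd hPi]

/-- THEOREM XXVIII(c) in values: `(1−m)·Π(N | m) = (1−n)·[(m/n)·K(m) + (1−m/n)·Π(n | m)]`,
`N = (m−n)/(1−n)`, every real algebraic `n < 1`, `n ≠ 0` [AS64, 17.7.17]. [this work] -/
theorem soloInformed_kummer_poleInvolution_law_value (m n : ℝ) (hm : m ∈ Ioo (0:ℝ) 1)
    (hma : IsAlgebraic ℚ m) (hn : n < 1) (hn0 : n ≠ 0) (hna : IsAlgebraic ℚ n)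
    (PN K P : IntegralRep 1) (hPNd : PN.domain = {x | x 0 ∈ Ioo (0:ℝ) 1})
    (hPNi : EqOn PN.integrand (fun x => (1 - (m - n) / (1 - n) * x 0 ^ 2)⁻¹ *
      ((√(1 - x 0 ^ 2))⁻¹ * (√(1 - m * x 0 ^ 2))⁻¹)) PN.domain)
    (hKd : K.domain = {x | x 0 ∈ Ioo (0:ℝ) 1})
    (hKi : EqOn K.integrand (fun x => (√(1 - x 0 ^ 2))⁻¹ * (√(1 - m * x 0 ^ 2))⁻¹) K.domain)
    (hPd : P.domain = {x | x 0 ∈ Ioo (0:ℝ) 1})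
    (hPi : EqOn P.integrand (fun x => (1 - n * x 0 ^ 2)⁻¹ *
      ((√(1 - x 0 ^ 2))⁻¹ * (√(1 - m * x 0 ^ 2))⁻¹)) P.domain) :
    (1 - m) * PN.value = (1 - n) * (m / n * K.value + (1 - m / n) * P.value) := by
  have hc1 : IsAlgebraic ℚ (m / n) := by rw [div_eq_mul_inv]; exact hma.mul hna.inv
  have h := congrArg evalP (soloInformed_kummer_poleInvolution_law m n hm hma hn hn0 hna hc1
    (isAlgebraic_one.sub hc1) PN K P hPNd hPNi hKd hKi hPd hPi)
  simpa only [map_mul, map_add, evalP_toFormalPeriod_of, IntegralRep.value_constMul,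
    IntegralRep.value_unit, mul_one] using h

/-! ### COROLLARY XXVIII.4 — the fixed point `n = 1 − √(1−m)`: `2k'·Π(1−k' | m) = (1+k')·K` -/

/-- **COROLLARY XXVIII.4 (the fixed point of the pole involution; 4-torsion, hyperbolic case).**
For real algebraic `0 < k' < 1`, `m = 1 − k'²`, with `Π = Π(1−k' | m) = [(0,1), f/(1−(1−k')x²)]`
and `K = [(0,1), f]`:  `2·⟦[pt,k']⟧·⟦Π⟧ = ⟦[pt,1+k']⟧·⟦K⟧` in `P` — the pole parameter
`n = 1 − k'` is FIXED by `n ↦ (m−n)/(1−n)`, so the move of THEOREM XXVIII(c) folds `Π` onto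
itself; ONE move and ONE application of rule (1b) [AS64, 17.7.23 at `φ = π/2`]. [this work] -/
theorem soloInformed_ellipticPi_fixedPole (k : ℝ) (hk : k ∈ Ioo (0:ℝ) 1) (hka : IsAlgebraic ℚ k)
    (P K : IntegralRep 1) (hPd : P.domain = {x | x 0 ∈ Ioo (0:ℝ) 1})
    (hPi : EqOn P.integrand (fun x => (1 - (1 - k) * x 0 ^ 2)⁻¹ *
      ((√(1 - x 0 ^ 2))⁻¹ * (√(1 - (1 - k ^ 2) * x 0 ^ 2))⁻¹)) P.domain)
    (hKd : K.domain = {x | x 0 ∈ Ioo (0:ℝ) 1})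
    (hKi : EqOn K.integrand (fun x => (√(1 - x 0 ^ 2))⁻¹ * (√(1 - (1 - k ^ 2) * x 0 ^ 2))⁻¹)
      K.domain) :
    2 * (toFormalPeriod (of (IntegralRep.unit.constMul k hka)) * toFormalPeriod (of P)) =
      toFormalPeriod (of (IntegralRep.unit.constMul (1 + k) (isAlgebraic_one.add hka))) *
        toFormalPeriod (of K) := by
  have hm : 1 - k ^ 2 ∈ Ioo (0:ℝ) 1 := ⟨by nlinarith [hk.1, hk.2], by nlinarith [hk.1, hk.2]⟩
  have hma : IsAlgebraic ℚ (1 - k ^ 2) := isAlgebraic_one.sub (hka.pow 2)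
  have hn : 1 - k < 1 := by linarith [hk.1]
  have hna : IsAlgebraic ℚ (1 - k) := isAlgebraic_one.sub hka
  have hk0 : k ≠ 0 := hk.1.ne'
  obtain ⟨Q, hQd, hQi⟩ := soloInformed_exists_kummerQ_rep (1 - k) (1 - k ^ 2) hn hna hm hma
  -- the move at the fixed point `N = n = 1 − k'`:  `k'²·⟦Π⟧ = k'·⟦Q⟧`
  have hN : (1 - k ^ 2 - (1 - k)) / (1 - (1 - k)) = 1 - k := by
    rw [show (1:ℝ) - k ^ 2 - (1 - k) = (1 - k) * k by ring, show (1:ℝ) - (1 - k) = k by ring,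
      mul_div_cancel_right₀ _ hk0]
  have h1 := soloInformed_kummer_involution (1 - k ^ 2) (1 - k) hm hma hn hna P Q hPd
    (fun x hx => by rw [hPi hx, hN]) hQd (fun x _ => hQi x)
  rw [← soloInformed_pointRep_mul_eq k k (1 - (1 - k ^ 2)) hka hka (isAlgebraic_one.sub hma)
    (by ring), soloInformed_pointRep_congr (isAlgebraic_one.sub hna) hka (by ring), mul_assoc] at h1
  have h2 := soloInformed_pointRep_cancel k hka hk0 h1
  -- rule (1b):  `⟦Q⟧ + k'·⟦Π⟧ = (1+k')·⟦K⟧`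
  have hmem : of (K.constMul (1 + k) (isAlgebraic_one.add hka)) - of Q - of (P.constMul k hka) ∈
      integrandAddRel := by
    refine ⟨1, _, Q, _, by rw [IntegralRep.domain_constMul, hKd, hQd],
      by rw [IntegralRep.domain_constMul, IntegralRep.domain_constMul, hPd, hKd], fun x hx => ?_,
      rfl⟩
    rw [IntegralRep.domain_constMul] at hx
    have hx' : x 0 ∈ Ioo (0:ℝ) 1 := by rw [hKd] at hx; exact hx
    have hp : 1 - (1 - k) * x 0 ^ 2 ≠ 0 := (soloInformed_poleFactor_pos hx' hn).ne'
    have key : (1 - (1 - k ^ 2) * x 0 ^ 2) / (1 - (1 - k) * x 0 ^ 2) +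
        k * (1 - (1 - k) * x 0 ^ 2)⁻¹ = 1 + k := by
      rw [← div_eq_mul_inv, ← add_div, div_eq_iff hp]
      ring
    have hxP : x ∈ P.domain := by rw [hPd]; exact hx'
    simp only [Pi.add_apply, IntegralRep.integrand_constMul, hKi hx, hQi, hPi hxP]
    rw [← key]
    ring
  have h3 := integrandAddRel_subset_relations hmem
  rw [sub_sub] at h3
  have h3' := toFormalPeriod_eq_iff.mpr h3
  rw [map_add, toFormalPeriod_of_constMul _ _ K, toFormalPeriod_of_constMul _ _ P] at h3'
  linear_combination h2 - h3'

/-- COROLLARY XXVIII.4 in values: `2k'·Π(1−k' | 1−k'²) = (1+k')·K(1−k'²)` — a complete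
elliptic integral of the third kind that is an algebraic multiple of `K`, `π`-free. [this work] -/
theorem soloInformed_ellipticPi_fixedPole_value (k : ℝ) (hk : k ∈ Ioo (0:ℝ) 1)
    (hka : IsAlgebraic ℚ k) (P K : IntegralRep 1) (hPd : P.domain = {x | x 0 ∈ Ioo (0:ℝ) 1})
    (hPi : EqOn P.integrand (fun x => (1 - (1 - k) * x 0 ^ 2)⁻¹ *
      ((√(1 - x 0 ^ 2))⁻¹ * (√(1 - (1 - k ^ 2) * x 0 ^ 2))⁻¹)) P.domain)
    (hKd : K.domain = {x | x 0 ∈ Ioo (0:ℝ) 1})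
    (hKi : EqOn K.integrand (fun x => (√(1 - x 0 ^ 2))⁻¹ * (√(1 - (1 - k ^ 2) * x 0 ^ 2))⁻¹)
      K.domain) :
    2 * (k * P.value) = (1 + k) * K.value := by
  have h := congrArg evalP (soloInformed_ellipticPi_fixedPole k hk hka P K hPd hPi hKd hKi)
  simpa only [map_mul, map_ofNat, evalP_toFormalPeriod_of, IntegralRep.value_constMul,
    IntegralRep.value_unit, mul_one] using h

end Summit.KontsevichZagierPeriods.KontsevichZagierPeriods.Theorems

end
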